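import Literature.Computability.Complexity.MCSPHardness
import Literature.Computability.Complexity.AdaptiveQueries
import Literature.Computability.Complexity.PlumbingBricks
import Literature.Computability.Complexity.FPStringBricks
import Literature.Computability.Complexity.FoldBricks
import Literature.Computability.Complexity.Williams2014
import Literature.Computability.Learning.SizeClassCounting
import Literature.Computability.MetaComplexity.TruthTablesProofs
import HarnessLib

/-!
# `MCSP ∈ P ⟹ P^NP ⊄ SIZE(O(n^k))` (Kabanets–Cai): the prefix-search language and its lower bound

Sibling proof file of `MCSPHardness.lean` (D-0014: the named fact
`Literature.Computability.Complexity.kabanets_cai_MCSP_mem_P`, **pnp.S33** second half, is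
discharged here as `kabanets_cai_MCSP_mem_P_holds`, sorry-free, together with its alias
`exists_mem_PRelClass_NP_not_mem_SIZE_of_MCSP_mem_P_holds`):

  `MCSP ∈ P → ∀ k, ∃ L ∈ P^NP, L ∉ ⋃_c SIZE(c·n^k + c)`.

Kabanets–Cai (STOC 2000), "what if MCSP is easy": if the circuit complexity of a given truth
table can be computed in polynomial time, then *hard truth tables can be constructed with an
`NP` oracle* — "is there a truth table of circuit complexity `> s` extending this prefix?" is an
`NP` question once hardness is a `P`-predicate, so a `P^NP` machine finds a hard table bit by
bit and the language it tabulates has high circuit complexity (the paper states the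
consequence for `E^NP`/`P^NP`; the vendored statement is the fixed-polynomial form for `P^NP`,
Thm. 10 in the numbering cited by the H21 inventory). This file formalises exactly that
argument over the tree's machine-free toolkit; no Turing machine is programmed.

## The language (`KabanetsCai.searchLang k`)

Fix `k`. At input length `n` the table length is `N = n^{2k+6}` and the hardness threshold is
`s = n^{k+2}`:

* `KabanetsCai.Hard k n T` — `|T| = n^{2k+6}` and `⟨T, bin(n^{k+2})⟩ ∉ MCSP` (G14's `MCSP`:
  `⟨tt f, bin s⟩ ∈ MCSP ↔ circuitSizeOver B2 f ≤ s`); `KabanetsCai.hardRel k = {⟨x, T⟩ | Hard k |x| T}`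
  is in `P` when `MCSP ∈ P` (`hardRel_mem_P`: an exact-length test `LenEq` and the complement of
  the preimage of `MCSP` under the `FP` map `⟨x, T⟩ ↦ ⟨T, bin(|x|^{k+2})⟩`) — the only use of the
  hypothesis;
* `KabanetsCai.PrefExt R p = {⟨x, w⟩ | ∃ v, |w ++ v| ≤ p(|x|) ∧ ⟨x, w ++ v⟩ ∈ R}` — the
  prefix-extension language of a `P`-relation is in `NP` (`PrefExt_mem_NP`; the mirror image of
  `SuffExt` of `SearchToDecision.lean`, Arora–Barak Thm. 2.18); the oracle is
  `KabanetsCai.oracle k = PrefExt (hardRel k) (X^{2k+6}) ∈ NP`;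
* the `P^NP` machine is the bounded adaptive reduction `AdQuery.adLang` of `AdaptiveQueries.lean`
  with query generator `qry ⟨x, b₀⋯b_{i-1}⟩ = ⟨x, b₀⋯b_{i-1}1⟩ ∈ FP`, `n^{2k+6}` rounds, and the
  evaluator `lookup = {⟨x, T⟩ | T[⟦x⟧] = 1} ∈ P` (little-endian address `⟦x⟧ = bitsToNat x`, read
  through the bounded binary-to-unary conversion `binToUnaryFn` and a suffix read,
  `Kannan.setOf_bit_mem_P`); hence **`searchLang_mem_PRelClass_NP : MCSP ∈ P → searchLang k ∈ P^NP`**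
  (`AdQuery.adLang_mem_PRelClass`).

## Semantics and the lower bound

* `exists_hard_extension`, `hard_table` — if some table is hard at length `n`, the answer bits
  `table k x i` of the search extend to a hard table after every round, so the full table
  `W = table k x (n^{2k+6})` is hard; `table_eq_of_length_eq` — it depends on `|x|` only;
  `mem_searchLang_iff` — `x ∈ L_k ↔ W[⟦x⟧] = 1`.
* `exists_lt_circuitSizeOver` — counting (Shannon; Arora–Barak Thm. 6.21 via
  `Learning.ncard_sizeClass_B2_le`): if `9(m+s+2)² < 2^m` some `f : {0,1}^m → {0,1}` has
  `circuitSizeOver B2 f > s`.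
* `exists_restrict` — hard-wiring the inputs `≥ m` of the `n`-th circuit of a deciding family to
  `0` (`Circuit.exists_hardwire`, `Williams2014.lean`; two extra constant gates) gives a circuit on
  `m` inputs for `y ↦ [y0^{n-m} ∈ L]`.
* `searchLang_not_mem_SIZE` — at `n = 2^a`, `a = 2k + c + 8` (so `N = 2^m`, `m = a(2k+6)`,
  `m + 2 ≤ s`, `8 ≤ n`, `c·n^k + c + 2 ≤ s`): a hard table exists, so `W` is the truth table of a
  function `g` on `m` variables of complexity `> s` (`boolPair_truthTable_mem_MCSP_iff`,
  `bitsToNat_ofFn`: the address of `y0^{n-m}` is the index of `y` in `boolFunEquivFin`), while the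
  restricted circuit computes `g` with `≤ c·n^k + c + 2 ≤ s` gates — so no family of size
  `c·n^k + c` decides `L_k`, for every `c`.

Design notes. The table length is the polynomial `n^{2k+6}` (the round budget of `adLang` is a
polynomial); it is a power of two — so that tables are truth tables and `MCSP` no-instances mean
hardness — at the lengths `n = 2^a`, which are the only lengths the lower bound uses (at other
lengths every table of that length is vacuously "hard" and the slice of `L_k` is whatever the
search produces; membership in `P^NP` is unaffected). The threshold `n^{k+2}` and the exponent
`2k + 6` absorb the quadratic loss of the tree's circuit count `2^{9(m+s+2)²}`.

## References

* V. Kabanets, J.-Y. Cai, *Circuit minimization problem*, Proc. 32nd STOC (2000) 73–79,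
  doi:10.1145/335305.335314 (ECCC TR99-045), the theorem "MCSP ∈ P ⟹ hard functions in
  `E^NP`/`P^NP`" (Thm. 10 as cited by the H21 inventory; the STOC text is paywalled and the ECCC
  scan has no text layer — acquisition filed; the argument formalised is the paper's prefix search
  with an `NP` oracle). [KabanetsCai2000]
* S. Arora, B. Barak, *Computational Complexity: A Modern Approach*, CUP 2009, Thm. 2.18
  (search-to-decision by an extension language), §3.4 (adaptive oracle machines), Thm. 6.21
  (counting), Def. 6.2/6.5 (`SIZE`). [AroraBarakCC2009]
* R. Kannan, *Circuit-size lower bounds and non-reducibility to sparse sets*, Inform. Control 55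
  (1982), Thm. 2 — the unconditional `Σ₂ᵖ` analogue (`KannanLanguage.lean`, whose string gadgets are
  reused). [Kannan1982]
-/

namespace Literature.Computability.Complexity

namespace KabanetsCai

open _root_.Computability Nondeterministic Classes MetaComplexity Learning Polynomial

/-! ### Counting: hard functions exist -/

/-- **Shannon's counting bound, in the tree's form.** If `9 (m + s + 2)² < 2^m` then some Boolean
function on `m` variables has `B₂`-circuit complexity `> s`: the functions of complexity `≤ s`
are at most `2^{9(m+s+2)²}` (`Learning.ncard_sizeClass_B2_le`, Arora–Barak's count of small
circuits) among the `2^{2^m}` functions. [cite: AroraBarakCC2009, Thm. 6.21 (proof, p. 116)] -/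
theorem exists_lt_circuitSizeOver (m s : ℕ) (h : 9 * (m + s + 2) ^ 2 < 2 ^ m) :
    ∃ f : (Fin m → Bool) → Bool, s < circuitSizeOver B2 f := by
  by_contra hcon
  push Not at hcon
  have hsub : (Set.univ : Set ((Fin m → Bool) → Bool)) ⊆ sizeClass B2 (fun _ => s) m := by
    intro f _
    obtain ⟨C, hC, hCf, hCs⟩ := exists_computes_B2_size_eq_holds f
    exact mem_sizeClass_iff.2 ⟨C, hC, hCf, hCs ▸ hcon f⟩
  have h1 : (Set.univ : Set ((Fin m → Bool) → Bool)).ncard ≤ 2 ^ (9 * (m + s + 2) ^ 2) :=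
    (Set.ncard_le_ncard hsub (Set.toFinite _)).trans (ncard_sizeClass_B2_le _ m)
  rw [Set.ncard_univ, Nat.card_eq_fintype_card, Fintype.card_fun, Fintype.card_bool,
    Fintype.card_fun, Fintype.card_bool, Fintype.card_fin] at h1
  have h2 := (Nat.pow_le_pow_iff_right (by norm_num : 1 < 2)).1 h1
  omega

/-! ### Little-endian values of tabulated assignments -/

/-- The value `bitsToNat` of the list of an assignment `y : Fin m → Bool` is its number in the
enumeration `boolFunEquivFin` (both are little-endian base-`2`). [cite: KabanetsCai2000, §2] -/
theorem bitsToNat_ofFn : ∀ {m : ℕ} (y : Fin m → Bool),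
    bitsToNat (List.ofFn y) = ((boolFunEquivFin m y : Fin (2 ^ m)) : ℕ) := by
  have key : ∀ {m : ℕ} (y : Fin m → Bool),
      bitsToNat (List.ofFn y) = ∑ i : Fin m, (y i).toNat * 2 ^ (i : ℕ) := by
    intro m
    induction m with
    | zero => intro y; simp
    | succ m ih =>
      intro y
      rw [List.ofFn_succ, bitsToNat_cons, ih, Fin.sum_univ_succ]
      simp only [Fin.val_zero, pow_zero, mul_one, Fin.val_succ, pow_succ]
      rw [Finset.mul_sum]
      congr 1
      refine Finset.sum_congr rfl fun i _ => ?_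
      ring
  intro m y
  rw [key]
  simp only [boolFunEquivFin, Equiv.trans_apply, finFunctionFinEquiv_apply,
    Equiv.arrowCongr_apply, Equiv.refl_symm, Equiv.coe_refl, Function.comp_apply, id_eq]
  refine Finset.sum_congr rfl fun i _ => ?_
  cases y i <;> rfl

/-! ### Arithmetic of the good lengths -/

/-- `a² ≤ 2^a` for `a ≥ 4`. [folklore] -/
theorem sq_le_two_pow {a : ℕ} (ha : 4 ≤ a) : a * a ≤ 2 ^ a := by
  induction a, ha using Nat.le_induction with
  | base => norm_num
  | succ a ha ih =>
    have : (a + 1) * (a + 1) ≤ 2 * (a * a) := by nlinarith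
    calc (a + 1) * (a + 1) ≤ 2 * (a * a) := this
      _ ≤ 2 * 2 ^ a := Nat.mul_le_mul_left 2 ih
      _ = 2 ^ (a + 1) := by rw [pow_succ]; ring

/-! ### Parameters and hardness of tables -/

/-- **Hard tables at length `n`.** `T` is *hard* (for the exponent `k`) at input length `n` if it
has length `n^{2k+6}` and the `MCSP`-instance `⟨T, bin(n^{k+2})⟩` is a no-instance, i.e. `T` is
the truth table of a function of `B₂`-circuit complexity `> n^{k+2}` (meaningful when `n^{2k+6}`
is a power of two, e.g. at the lengths `n = 2^a`). [cite: KabanetsCai2000, Thm. 10] -/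
def Hard (k n : ℕ) (T : List Bool) : Prop :=
  T.length = n ^ (2 * k + 6) ∧ boolPair T (encodeNat (n ^ (k + 2))) ∉ MCSP

/-- The size-query map `⟨x, T⟩ ↦ ⟨T, bin(|x|^{k+2})⟩` (an `MCSP` instance). [folklore] -/
noncomputable def sizeQuery (k : ℕ) : List Bool → List Bool :=
  fanoutFn sndP (Brick.lenBinF ∘ Plumb.polyFn (X ^ (k + 2)) ∘ fstP)

/-- Value of `sizeQuery` on a pair. [folklore] -/
@[simp] theorem sizeQuery_boolPair (k : ℕ) (x T : List Bool) :
    sizeQuery k (boolPair x T) = boolPair T (encodeNat (x.length ^ (k + 2))) := by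
  simp [sizeQuery]

/-- `sizeQuery k ∈ FP`. [cite: AroraBarakCC2009, §1.3] -/
theorem sizeQuery_mem_FP (k : ℕ) : sizeQuery k ∈ FP :=
  fanoutFn_mem_FP sndP_mem_FP
    (comp_mem_FP Brick.lenBinF_mem_FP (comp_mem_FP (Plumb.polyFn_mem_FP _) fstP_mem_FP))

/-- **The hardness relation** `{⟨x, T⟩ | T is hard at length |x|}`, as the intersection of the
exact-length language `LenEq (X^{2k+6})` with the complement of the preimage of `MCSP` under
`sizeQuery`. [cite: KabanetsCai2000, Thm. 10] -/
noncomputable def hardRel (k : ℕ) : Language Bool :=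
  LenEq (X ^ (2 * k + 6)) ⊓ (sizeQuery k ⁻¹' MCSP)ᶜ

/-- Membership of a pair in `hardRel k`. [folklore] -/
theorem boolPair_mem_hardRel (k : ℕ) (x T : List Bool) :
    boolPair x T ∈ hardRel k ↔ Hard k x.length T := by
  change boolPair x T ∈ LenEq (X ^ (2 * k + 6)) ∧ ¬ sizeQuery k (boolPair x T) ∈ MCSP ↔ _
  rw [boolPair_mem_LenEq, sizeQuery_boolPair]
  simp [Hard]

/-- **With `MCSP ∈ P`, hardness is polynomial-time**: `hardRel k ∈ P`. This is the one place
where the hypothesis `MCSP ∈ P` enters. [cite: KabanetsCai2000, Thm. 10] -/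
theorem hardRel_mem_P (k : ℕ) (hM : MCSP ∈ Classes.P) : hardRel k ∈ Classes.P :=
  inter_mem_P (LenEq_mem_P _) (compl_mem_P_iff.2 (preimage_mem_P hM (sizeQuery_mem_FP k)))

/-! ### Prefix-extension languages are in `NP` -/

section PrefExt

variable (R : Language Bool) (p : Polynomial ℕ)

/-- **The prefix-extension language** of a relation `R` with length bound `p`:
`⟨x, w⟩ ∈ PrefExt R p` iff `w` extends — by appending — to some `T = w ++ v` with
`|T| ≤ p(|x|)` and `⟨x, T⟩ ∈ R` (the `NP` set of extendable partial solutions queried once per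
bit by a prefix search; Arora–Barak 2009, proof of Thm. 2.18; cf. `SuffExt` of
`SearchToDecision.lean`, which grows at the front). [cite: AroraBarakCC2009, Thm. 2.18] -/
def PrefExt : Language Bool :=
  {z | ∃ v : List Bool, ((boolUnpair z).2 ++ v).length ≤ p.eval (boolUnpair z).1.length ∧
    boolPair (boolUnpair z).1 ((boolUnpair z).2 ++ v) ∈ R}

/-- Membership of a pair in `PrefExt R p`. [folklore] -/
theorem boolPair_mem_PrefExt (x w : List Bool) :
    boolPair x w ∈ PrefExt R p ↔
      ∃ v : List Bool, (w ++ v).length ≤ p.eval x.length ∧ boolPair x (w ++ v) ∈ R := by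
  change (∃ v : List Bool, _ ∧ _) ↔ _
  rw [boolUnpair_boolPair]

/-- The verifier's recombination map `⟨⟨x, w⟩, v⟩ ↦ ⟨x, w ++ v⟩`. [cite: AroraBarakCC2009, Thm. 2.8 (proof)] -/
noncomputable def prefMap : List Bool → List Bool :=
  fanoutFn (fstP ∘ fstP) (fun u => sndP (fstP u) ++ sndP u)

/-- Value of `prefMap`. [folklore] -/
theorem prefMap_apply (u : List Bool) :
    prefMap u = boolPair (boolUnpair (boolUnpair u).1).1
      ((boolUnpair (boolUnpair u).1).2 ++ (boolUnpair u).2) := by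
  simp [prefMap, fstP, sndP]

/-- `prefMap ∈ FP`. [cite: AroraBarakCC2009, Thm. 2.8 (proof)] -/
theorem prefMap_mem_FP : prefMap ∈ FP :=
  fanoutFn_mem_FP (comp_mem_FP fstP_mem_FP fstP_mem_FP)
    (append_mem_FP (comp_mem_FP sndP_mem_FP fstP_mem_FP) sndP_mem_FP)

/-- The verifier language of `PrefExt R p`: `⟨⟨x, w⟩, v⟩ ∈ PrefRel R p ↔ ⟨x, w ++ v⟩ ∈ R ∧ |w ++ v| ≤ p(|x|)`.
[cite: AroraBarakCC2009, Def. 2.1] -/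
def PrefRel : Language Bool :=
  prefMap ⁻¹' (R ⊓ LenLe p)

/-- Membership of a pair in `PrefRel R p`. [folklore] -/
theorem boolPair_mem_PrefRel (z v : List Bool) :
    boolPair z v ∈ PrefRel R p ↔
      boolPair (boolUnpair z).1 ((boolUnpair z).2 ++ v) ∈ R ∧
        ((boolUnpair z).2 ++ v).length ≤ p.eval (boolUnpair z).1.length := by
  change prefMap (boolPair z v) ∈ R ∧ prefMap (boolPair z v) ∈ LenLe p ↔ _
  rw [prefMap_apply, boolUnpair_boolPair, boolPair_mem_LenLe]

/-- `PrefRel R p ∈ P` for `R ∈ P`. [cite: AroraBarakCC2009, Thm. 2.8 (proof)] -/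
theorem PrefRel_mem_P (hR : R ∈ Classes.P) : PrefRel R p ∈ Classes.P :=
  preimage_mem_P (inter_mem_P hR (LenLe_mem_P p)) prefMap_mem_FP

/-- **The prefix-extension language of a `P` relation is in `NP`** (witness `v`,
`|v| ≤ |w ++ v| ≤ p(|x|) ≤ p(|⟨x, w⟩|)`). [cite: AroraBarakCC2009, Thm. 2.18] -/
theorem PrefExt_mem_NP (hR : R ∈ Classes.P) : PrefExt R p ∈ Nondeterministic.NP := by
  refine ⟨PrefRel R p, PrefRel_mem_P R p hR, p, fun z => ?_⟩
  constructor
  · rintro ⟨v, hv, hvR⟩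
    refine ⟨v, ?_, (boolPair_mem_PrefRel R p z v).2 ⟨hvR, hv⟩⟩
    calc v.length ≤ ((boolUnpair z).2 ++ v).length := by simp
      _ ≤ p.eval (boolUnpair z).1.length := hv
      _ ≤ p.eval z.length := TM2Iter.eval_mono p (length_boolUnpair_fst_le z)
  · rintro ⟨v, -, hv⟩
    obtain ⟨hvR, hvl⟩ := (boolPair_mem_PrefRel R p z v).1 hv
    exact ⟨v, hvl, hvR⟩

end PrefExt

/-! ### The query generator, the table look-up, the oracle and the language -/

/-- **The query generator** of the prefix search: `⟨x, b₀ ⋯ b_{i-1}⟩ ↦ ⟨x, b₀ ⋯ b_{i-1} 1⟩`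
("does the current prefix, extended by `1`, extend to a hard table?"). [cite: KabanetsCai2000, Thm. 10] -/
noncomputable def qry : List Bool → List Bool :=
  fanoutFn fstP (fun w => sndP w ++ [true])

/-- Value of `qry` on a pair. [folklore] -/
@[simp] theorem qry_boolPair (x w : List Bool) : qry (boolPair x w) = boolPair x (w ++ [true]) := by
  simp [qry]

/-- `qry ∈ FP`. [cite: AroraBarakCC2009, §1.3] -/
theorem qry_mem_FP : qry ∈ FP :=
  fanoutFn_mem_FP fstP_mem_FP (append_mem_FP sndP_mem_FP (const_mem_FP [true]))

/-- The unary address `⟨x, T⟩ ↦ 1^{min ⟦x⟧ |T|}` (bounded binary-to-unary conversion,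
`binToUnaryFn`). [cite: AroraBarakCC2009, §1.3] -/
noncomputable def addrFn : List Bool → List Bool :=
  binToUnaryFn ∘ fanoutFn sndP fstP

/-- Value of `addrFn` on a pair. [folklore] -/
@[simp] theorem addrFn_boolPair (x T : List Bool) :
    addrFn (boolPair x T) = ones (min (bitsToNat x) T.length) := by
  simp [addrFn]

/-- `addrFn ∈ FP`. [cite: AroraBarakCC2009, §1.3] -/
theorem addrFn_mem_FP : addrFn ∈ FP :=
  comp_mem_FP binToUnaryFn_mem_FP (fanoutFn_mem_FP sndP_mem_FP fstP_mem_FP)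

/-- **The table look-up**: `⟨x, T⟩ ∈ lookup` iff the entry of `T` at the little-endian address
`⟦x⟧ = bitsToNat x` is `1` (addresses beyond the table are rejected). [cite: KabanetsCai2000, Thm. 10] -/
def lookup : Language Bool :=
  {w | ((sndP w).drop (addrFn w).length).head? = some true}

/-- Membership of a pair in `lookup`. [folklore] -/
theorem boolPair_mem_lookup (x T : List Bool) :
    boolPair x T ∈ lookup ↔ (T.drop (min (bitsToNat x) T.length)).head? = some true := by
  change ((sndP (boolPair x T)).drop (addrFn (boolPair x T)).length).head? = some true ↔ _
  rw [sndP_boolPair, addrFn_boolPair, List.length_replicate]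

/-- For a table address inside the table, `lookup` reads the entry. [folklore] -/
theorem boolPair_mem_lookup_iff_getD (x T : List Bool) :
    boolPair x T ∈ lookup ↔ T.getD (bitsToNat x) false = true := by
  rw [boolPair_mem_lookup]
  rcases le_or_gt T.length (bitsToNat x) with h | h
  · rw [min_eq_right h, List.drop_of_length_le le_rfl, List.getD_eq_default _ _ h]
    simp
  · rw [min_eq_left h.le, Kannan.head?_drop_eq_some_true_iff]

/-- `lookup ∈ P`. [cite: AroraBarakCC2009, §1.3] -/
theorem lookup_mem_P : lookup ∈ Classes.P :=
  Kannan.setOf_bit_mem_P addrFn_mem_FP sndP_mem_FP true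

/-- **The `NP` oracle** `A_k = PrefExt (hardRel k) (X^{2k+6})`: `⟨x, w⟩ ∈ A_k` iff `w` is a prefix
of a table that is hard at length `|x|`. [cite: KabanetsCai2000, Thm. 10] -/
noncomputable def oracle (k : ℕ) : Language Bool :=
  PrefExt (hardRel k) (X ^ (2 * k + 6))

/-- `A_k ∈ NP` when `MCSP ∈ P`. [cite: KabanetsCai2000, Thm. 10] -/
theorem oracle_mem_NP (k : ℕ) (hM : MCSP ∈ Classes.P) : oracle k ∈ Nondeterministic.NP :=
  PrefExt_mem_NP _ _ (hardRel_mem_P k hM)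

/-- Membership of a pair in the oracle: `⟨x, w⟩ ∈ A_k ↔ ∃ v, Hard k |x| (w ++ v)`. [folklore] -/
theorem boolPair_mem_oracle (k : ℕ) (x w : List Bool) :
    boolPair x w ∈ oracle k ↔ ∃ v : List Bool, Hard k x.length (w ++ v) := by
  rw [oracle, boolPair_mem_PrefExt]
  refine exists_congr fun v => ?_
  rw [boolPair_mem_hardRel]
  simp only [eval_pow, eval_X, and_iff_right_iff_imp]
  exact fun h => h.1.le

/-- **The language `L_k`**: the bounded adaptive reduction (`AdQuery.adLang`) that asks the
`|x|^{2k+6}` prefix-search queries `qry` to `A_k` and then looks the input up in the table of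
answer bits. [cite: KabanetsCai2000, Thm. 10] -/
noncomputable def searchLang (k : ℕ) : Language Bool :=
  AdQuery.adLang qry (X ^ (2 * k + 6)) lookup (oracle k)

/-- **`L_k ∈ P^NP`** when `MCSP ∈ P` (`AdQuery.adLang_mem_PRelClass`). [cite: KabanetsCai2000, Thm. 10] -/
theorem searchLang_mem_PRelClass_NP (k : ℕ) (hM : MCSP ∈ Classes.P) :
    searchLang k ∈ PRelClass Nondeterministic.NP :=
  AdQuery.adLang_mem_PRelClass qry_mem_FP lookup_mem_P (oracle_mem_NP k hM)

/-! ### Semantics of the prefix search -/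

/-- The table prefix after `i` rounds: the answer bits `adBits` of the adaptive reduction.
[cite: KabanetsCai2000, Thm. 10] -/
noncomputable def table (k : ℕ) (x : List Bool) (i : ℕ) : List Bool :=
  AdQuery.adBits qry (oracle k) x i

/-- No rounds, empty prefix. [folklore] -/
@[simp] theorem table_zero (k : ℕ) (x : List Bool) : table k x 0 = [] := rfl

/-- One more round: the next bit is the oracle's answer to `⟨x, prefix 1⟩`. [folklore] -/
theorem table_succ (k : ℕ) (x : List Bool) (i : ℕ) :
    table k x (i + 1) =
      table k x i ++ [(oracle k).boolIndicator (boolPair x (table k x i ++ [true]))] := by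
  rw [table, AdQuery.adBits_succ, qry_boolPair]
  rfl

/-- The prefix after `i` rounds has length `i`. [folklore] -/
@[simp] theorem length_table (k : ℕ) (x : List Bool) (i : ℕ) : (table k x i).length = i :=
  AdQuery.length_adBits _ _ _

/-- Indicators agree on elements with the same membership. [folklore] -/
theorem boolIndicator_congr {α : Type*} {s : Set α} {a b : α} (h : a ∈ s ↔ b ∈ s) :
    s.boolIndicator a = s.boolIndicator b := by
  by_cases ha : a ∈ s
  · rw [(Set.mem_iff_boolIndicator _ _).1 ha, (Set.mem_iff_boolIndicator _ _).1 (h.1 ha)]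
  · rw [(Set.notMem_iff_boolIndicator _ _).1 ha,
      (Set.notMem_iff_boolIndicator _ _).1 (fun hb => ha (h.2 hb))]

/-- **The table depends only on the input length** (every query `⟨x, w⟩` is answered according
to `|x|` and `w` alone). [folklore] -/
theorem table_eq_of_length_eq (k : ℕ) {x x' : List Bool} (h : x.length = x'.length) :
    ∀ i, table k x i = table k x' i
  | 0 => rfl
  | i + 1 => by
    have hiff : boolPair x (table k x' i ++ [true]) ∈ oracle k ↔
        boolPair x' (table k x' i ++ [true]) ∈ oracle k := by
      rw [boolPair_mem_oracle, boolPair_mem_oracle, h]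
    rw [table_succ, table_succ, table_eq_of_length_eq k h i, boolIndicator_congr hiff]

/-- **Invariant of the prefix search**: if some table is hard at length `n = |x|`, then after
every round `i ≤ n^{2k+6}` the prefix extends to a hard table (answer `1`: by the oracle;
answer `0`: the hard extension of the previous prefix cannot continue with `1`, so it
continues with `0`). [cite: KabanetsCai2000, Thm. 10] -/
theorem exists_hard_extension (k : ℕ) {n : ℕ} (hex : ∃ T, Hard k n T) {x : List Bool}
    (hx : x.length = n) : ∀ i, i ≤ n ^ (2 * k + 6) → ∃ v : List Bool, Hard k n (table k x i ++ v)
  | 0, _ => by simpa using hex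
  | i + 1, hi => by
    obtain ⟨v, hv⟩ := exists_hard_extension k hex hx i (Nat.le_of_succ_le hi)
    rw [table_succ]
    by_cases hmem : boolPair x (table k x i ++ [true]) ∈ oracle k
    · rw [(Set.mem_iff_boolIndicator _ _).1 hmem]
      obtain ⟨v', hv'⟩ := (boolPair_mem_oracle k x _).1 hmem
      rw [hx] at hv'
      exact ⟨v', by simpa [List.append_assoc] using hv'⟩
    · rw [(Set.notMem_iff_boolIndicator _ _).1 hmem]
      match v, hv with
      | [], hv =>
        have hlen := hv.1
        rw [List.append_nil, length_table] at hlen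
        omega
      | false :: v', hv => exact ⟨v', by simpa [List.append_assoc] using hv⟩
      | true :: v', hv =>
        exfalso
        apply hmem
        rw [boolPair_mem_oracle, hx]
        exact ⟨v', by simpa [List.append_assoc] using hv⟩

/-- **The full table is hard** (when some table is hard at that length). [cite: KabanetsCai2000, Thm. 10] -/
theorem hard_table (k : ℕ) {n : ℕ} (hex : ∃ T, Hard k n T) {x : List Bool} (hx : x.length = n) :
    Hard k n (table k x (n ^ (2 * k + 6))) := by
  obtain ⟨v, hv⟩ := exists_hard_extension k hex hx _ le_rfl
  have hlen := hv.1
  rw [List.length_append, length_table] at hlen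
  obtain rfl : v = [] := List.eq_nil_of_length_eq_zero (by omega)
  simpa using hv

/-- **Membership in `L_k`**: `x ∈ L_k` iff the table at length `|x|` has entry `1` at address
`⟦x⟧`. [cite: KabanetsCai2000, Thm. 10] -/
theorem mem_searchLang_iff (k : ℕ) (x : List Bool) :
    x ∈ searchLang k ↔ (table k x (x.length ^ (2 * k + 6))).getD (bitsToNat x) false = true := by
  rw [searchLang, AdQuery.mem_adLang_iff, eval_pow, eval_X, boolPair_mem_lookup_iff_getD]
  rfl

/-! ### Restricting a deciding circuit to a prefix of the inputs -/

/-- The constant `0 = ∨₀` is a `B₂` gate. [folklore] -/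
theorem or_zero_mem_B2 : GateFn.or 0 ∈ B2 := by
  change (0 : ℕ) ≤ 2
  omega

/-- The constant `1 = ∧₀` is a `B₂` gate. [folklore] -/
theorem and_zero_mem_B2 : GateFn.and 0 ∈ B2 := by
  change (0 : ℕ) ≤ 2
  omega

/-- A string of zeros reads `0` everywhere. [folklore] -/
theorem getD_replicate_false (r i : ℕ) : (List.replicate r false).getD i false = false := by
  rw [List.getD_eq_getElem?_getD, List.getElem?_replicate]
  split <;> rfl

/-- The deciding circuit at length `n`, on an input given as a list of length `n` read with
default `0`. [cite: AroraBarak2009, Def. 6.2] -/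
theorem eval_getD_of_decides {C : CircuitFamily} {L : Language Bool} (hdec : C.Decides L)
    {x : List Bool} {n : ℕ} (hx : x.length = n) :
    (C n).eval (fun j : Fin n => x.getD j false) = L.boolIndicator x := by
  subst hx
  rw [← hdec x]
  congr 1
  funext j
  rw [List.getD_eq_getElem _ _ j.2, List.get_eq_getElem]

/-- **Restriction to the first `m` inputs.** From the `n`-th circuit (over `B₂`) of a family
deciding `L` and `m ≤ n`, hard-wiring the inputs `m, …, n-1` to `0` (`Circuit.exists_hardwire`,
two extra constant gates) gives a `B₂`-circuit on `m` inputs computing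
`y ↦ [y 0^{n-m} ∈ L]`. [cite: Williams2014, Lemma 5.1] -/
theorem exists_restrict {C : CircuitFamily} {L : Language Bool} (hdec : C.Decides L) {n : ℕ}
    (hC : (C n).IsOver B2) {m : ℕ} (hm : m ≤ n) :
    ∃ D : Circuit (Fin m), D.IsOver B2 ∧ D.size ≤ (C n).size + 2 ∧
      ∀ y : Fin m → Bool,
        D.eval y = L.boolIndicator (List.ofFn y ++ List.replicate (n - m) false) := by
  let σ : Fin n → Fin m ⊕ Bool := fun j =>
    if h : (j : ℕ) < m then Sum.inl ⟨j, h⟩ else Sum.inr false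
  obtain ⟨D, hD, hsize, -, heval⟩ :=
    Circuit.exists_hardwire or_zero_mem_B2 and_zero_mem_B2 (C n) hC σ
  refine ⟨D, hD, hsize, fun y => ?_⟩
  have hx : (List.ofFn y ++ List.replicate (n - m) false).length = n := by
    simp; omega
  rw [heval, ← eval_getD_of_decides hdec hx]
  congr 1
  funext j
  by_cases h : (j : ℕ) < m
  · simp only [σ, dif_pos h, Sum.elim_inl]
    rw [List.getD_append _ _ _ _ (by simpa using h), Kannan.getD_ofFn _ h]
  · simp only [σ, dif_neg h, Sum.elim_inr, id]
    rw [List.getD_append_right _ _ _ _ (by simpa using Nat.le_of_not_lt h), getD_replicate_false]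

/-! ### The lower bound -/

/-- **`L_k` has no `O(n^k)`-size circuits.** At the length `n = 2^a`, `a = 2k + c + 8`: a table
hard at `n` exists by counting (`m = a(2k+6)` variables, threshold `s = n^{k+2}`,
`9(m+s+2)² < 2^m = n^{2k+6}`), so the table `W` found by the search is hard, i.e. the function
`g` with truth table `W` has `B₂`-complexity `> s`; but the `n`-th circuit of a family of size
`≤ c·n^k + c` deciding `L_k`, restricted to its first `m` inputs, computes `g` with
`≤ c·n^k + c + 2 ≤ s` gates. [cite: KabanetsCai2000, Thm. 10] -/
theorem searchLang_not_mem_SIZE (k c : ℕ) : searchLang k ∉ SIZE (fun n => c * n ^ k + c) := by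
  rintro ⟨C, hC, hdec⟩
  -- parameters
  obtain ⟨a, ha⟩ : ∃ a, a = 2 * k + c + 8 := ⟨_, rfl⟩
  obtain ⟨n, hn⟩ : ∃ n, n = 2 ^ a := ⟨_, rfl⟩
  obtain ⟨m, hm⟩ : ∃ m, m = a * (2 * k + 6) := ⟨_, rfl⟩
  obtain ⟨s, hs⟩ : ∃ s, s = n ^ (k + 2) := ⟨_, rfl⟩
  have hNm : n ^ (2 * k + 6) = 2 ^ m := by rw [hn, hm, ← pow_mul]
  -- arithmetic of the good length
  have hsq : a * a ≤ n := hn ▸ sq_le_two_pow (by omega)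
  have h8n : 8 ≤ n := by
    have : 2 ^ 3 ≤ 2 ^ a := Nat.pow_le_pow_right (by norm_num) (by omega)
    omega
  have h1n : 1 ≤ n := by omega
  have hns : n ≤ s := by
    rw [hs, pow_succ]
    exact Nat.le_mul_of_pos_left n (pow_pos (by omega) _)
  have hm2a : m + 2 ≤ a * a := by
    rw [hm]
    have : a * (2 * k + 6) + 2 ≤ a * (2 * k + 8) := by nlinarith
    exact this.trans (Nat.mul_le_mul_left a (by omega))
  have hm2s : m + 2 ≤ s := hm2a.trans (hsq.trans hns)
  have hmn : m ≤ n := by omega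
  have hcs : c * n ^ k + c + 2 ≤ s := by
    have hk1 : 1 ≤ n ^ k := Nat.one_le_pow _ _ h1n
    have h2c : 2 * c + 2 ≤ n := by nlinarith
    calc c * n ^ k + c + 2 ≤ c * n ^ k + (c + 2) * n ^ k := by nlinarith
      _ = (2 * c + 2) * n ^ k := by ring
      _ ≤ n * n ^ k := Nat.mul_le_mul_right _ h2c
      _ = n ^ (k + 1) := by rw [pow_succ]; ring
      _ ≤ n ^ (k + 2) := Nat.pow_le_pow_right h1n (by omega)
      _ = s := hs.symm
  have hcount : 9 * (m + s + 2) ^ 2 < 2 ^ m := by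
    rw [← hNm]
    have hN : n ^ (2 * k + 6) = s * s * (n * n) := by rw [hs]; ring
    rw [hN]
    have h1s : 1 ≤ s := h1n.trans hns
    have h64 : 64 ≤ n * n := by nlinarith
    calc 9 * (m + s + 2) ^ 2 ≤ 9 * (2 * s) ^ 2 := by
          have : m + s + 2 ≤ 2 * s := by omega
          exact Nat.mul_le_mul_left 9 (Nat.pow_le_pow_left this 2)
      _ = 36 * (s * s) := by ring
      _ < 64 * (s * s) := by nlinarith
      _ ≤ s * s * (n * n) := by nlinarith
  -- a hard table exists at length `n`, hence the table `W` of the search is hard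
  obtain ⟨f, hf⟩ := exists_lt_circuitSizeOver m s hcount
  have hex : ∃ T, Hard k n T :=
    ⟨truthTable f, by rw [length_truthTable, hNm], by
      rw [boolPair_truthTable_mem_MCSP_iff]; omega⟩
  have hx₀ : (List.replicate n false).length = n := List.length_replicate
  obtain ⟨W, hW⟩ : ∃ W, W = table k (List.replicate n false) (n ^ (2 * k + 6)) := ⟨_, rfl⟩
  have hWhard : Hard k n W := hW ▸ hard_table k hex hx₀
  have hWlen : W.length = 2 ^ m := hWhard.1.trans hNm
  -- the function `g` with truth table `W` is hard …
  have hg : ¬ circuitSizeOver B2 (ofTruthTable W hWlen) ≤ s := by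
    rw [hs]
    have h2 := hWhard.2
    rwa [← truthTable_ofTruthTable W hWlen, boolPair_truthTable_mem_MCSP_iff] at h2
  -- … but the restricted `n`-th circuit computes it within size `s`
  obtain ⟨D, hD, hDsize, hDeval⟩ := exists_restrict hdec (hC n).1 hmn
  refine hg ((circuitSizeOver_le_of_computes D hD fun y => ?_).trans
    (hDsize.trans ((Nat.add_le_add_right (hC n).2 2).trans hcs)))
  rw [hDeval]
  have hx : (List.ofFn y ++ List.replicate (n - m) false).length = n := by simp; omega
  have hval : bitsToNat (List.ofFn y ++ List.replicate (n - m) false) =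
      ((boolFunEquivFin m y : Fin (2 ^ m)) : ℕ) := by
    rw [bitsToNat_append, bitsToNat_replicate_false, mul_zero, add_zero, bitsToNat_ofFn]
  have hmem : List.ofFn y ++ List.replicate (n - m) false ∈ searchLang k ↔
      W.getD ((boolFunEquivFin m y : Fin (2 ^ m)) : ℕ) false = true := by
    rw [mem_searchLang_iff, hx, hval, hW, table_eq_of_length_eq k (hx.trans hx₀.symm)]
  have hgy : ofTruthTable W hWlen y = W.getD ((boolFunEquivFin m y : Fin (2 ^ m)) : ℕ) false := by
    rw [ofTruthTable, List.get_eq_getElem, List.getD_eq_getElem]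
    rfl
  rw [hgy]
  by_cases hxL : List.ofFn y ++ List.replicate (n - m) false ∈ searchLang k
  · rw [(Set.mem_iff_boolIndicator _ _).1 hxL, hmem.1 hxL]
  · rw [(Set.notMem_iff_boolIndicator _ _).1 hxL]
    have h2 : ¬ W.getD ((boolFunEquivFin m y : Fin (2 ^ m)) : ℕ) false = true := fun h => hxL (hmem.2 h)
    simpa using h2

/-- `L_k ∉ ⋃_c SIZE(c·n^k + c)`. [cite: KabanetsCai2000, Thm. 10] -/
theorem searchLang_not_mem_iUnion_SIZE (k : ℕ) : searchLang k ∉ ⋃ c : ℕ, SIZE (fun n => c * n ^ k + c) := by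
  rw [Set.mem_iUnion]
  rintro ⟨c, hc⟩
  exact searchLang_not_mem_SIZE k c hc

end KabanetsCai

/-! ### Discharge -/

open KabanetsCai in
/-- **Kabanets–Cai: `MCSP ∈ P` implies `P^NP ⊄ SIZE(O(n^k))` for every `k`** — discharge of the
named fact `kabanets_cai_MCSP_mem_P`: the witness is `KabanetsCai.searchLang k ∈ P^NP`
(`searchLang_mem_PRelClass_NP`, the only use of `MCSP ∈ P`) with `searchLang_not_mem_iUnion_SIZE`.
[cite: KabanetsCai2000, Thm. 10] -/
theorem kabanets_cai_MCSP_mem_P_holds : kabanets_cai_MCSP_mem_P := fun hM k =>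
  ⟨searchLang k, searchLang_mem_PRelClass_NP k hM, searchLang_not_mem_iUnion_SIZE k⟩

/-- Discharge of the Mathlib-style alias. [cite: KabanetsCai2000, Thm. 10] -/
theorem exists_mem_PRelClass_NP_not_mem_SIZE_of_MCSP_mem_P_holds :
    exists_mem_PRelClass_NP_not_mem_SIZE_of_MCSP_mem_P :=
  kabanets_cai_MCSP_mem_P_holds

end Literature.Computability.Complexity
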